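import Summits.BirchSwinnertonDyer.BirchSwinnertonDyer.Theorems.Rank2ObservatoryRank3PSatS10CpsCensusA
import Summits.BirchSwinnertonDyer.BirchSwinnertonDyer.Theorems.Rank2ObservatoryRank3PSatS10CpsCensusB
import Summits.BirchSwinnertonDyer.BirchSwinnertonDyer.Theorems.Rank2ObservatoryRank3PSatS10CpsCensusC
import Summits.BirchSwinnertonDyer.BirchSwinnertonDyer.Theorems.Rank2ObservatoryRank3GeneratorsCensusA
import Summits.BirchSwinnertonDyer.BirchSwinnertonDyer.Theorems.Rank2ObservatoryRank3GeneratorsCensusB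
import Summits.BirchSwinnertonDyer.BirchSwinnertonDyer.Theorems.Rank2ObservatoryRank3GeneratorsCensusC
import HarnessLib

/-!
# BirchSwinnertonDyer — rank ≥ 2 observatory: GENERATORS CENSUS of record — TAIL SUPPLEMENT (S10-CPS), chunks 01–14

HONEST FRAMING: per-curve certified theorems and census instruments; no claim on BSD in rank ≥ 2.

THE TAIL SUPPLEMENT of the generators census of record (`GeneratorsCensus.generatorsNN` /
`censusNN`, files `…GeneratorsCensusA–F`: 9091 of the 9487 rank-3 table rows, residual 396 = exactly
the rows with register-J11 bound `> 100`) by the LANDED S10-CPS census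
(`PSatCensusS10CPS.generatorsNN`, files `…PSatS10CpsCensusA–E`, register J11c: the residual rows
with the two-implementation Cremona–Prickett–Siksek-bound search datum `m ≤ 10` — Hermite, or `m =
1` by saturation-by-exhaustive-search — joined with KS3 exactly like the S10 census; EMPTY
certificate lists, nothing beyond `p ≤ 7`). Per chunk NN ONE theorem `censusTNN` lets the KERNEL
recompute the census from the statements of `GeneratorsCensus.generatorsNN` (list `U`) and of the
chunk's S10-CPS generator theorem (list `V`), both entering by unification — nothing restated, no
definitions, no new certificates, no data as hypotheses, no `native_decide`: the lengths of `U` and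
`V`, the number of rows of the chunk, and the exact positions still uncovered (labels in the
docstring, if any). Whole table: 9091 + 396 = 9487 of 9487 rows covered, residual 0
(`census_total_tail`).

References: Cremona–Prickett–Siksek, J. Number Theory 116 (2006) 42–68 [CremonaPrickettSiksek2006];
Siksek, Rocky Mountain J. Math. 25 (1995) §3; Cremona, *Algorithms for Modular Elliptic Curves*
(1997) §3.5 and Tables; Silverman, *The Arithmetic of Elliptic Curves* (2009) VIII.6.7.
-/

-- single-conjunct summit: `Summit.BirchSwinnertonDyer.BirchSwinnertonDyer.…` repeats the name
set_option linter.dupNamespace false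

namespace Summit.BirchSwinnertonDyer.BirchSwinnertonDyer.Rank2Observatory

namespace GeneratorsCensus

open Rank3KernelRankCensusN9365 (rows mem_rank3Table rank_eq_three)

/-- **CENSUS WITH THE TAIL, chunk 01** (kernel-computed from the statements of `generators01` — list
`U`, `350` entries — and of `PSatCensusS10CPS.generators01` — list `V`, the `2` tail rows at
positions 178, 274; nothing restated): `352` rows, and NO position remains uncovered. [cite:
CremonaPrickettSiksek2006, Thm 1] [cite: CremonaAlgorithms1997, Tables] -/
theorem censusT01 : ∃ U V : List (ℕ × ℕ),
    (∀ e ∈ U, ∃ r, rank3Rows01[e.1]? = some r ∧ ∀ (hr : r ∈ rows) (h : r.check = true),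
        (AddSubgroup.closure {r.gen₁ h, r.gen₂ h, r.gen₃ h} ⊔ AddCommGroup.torsion _).index ≤ e.2 →
          AddSubgroup.closure {r.gen₁ h, r.gen₂ h, r.gen₃ h} ⊔ AddCommGroup.torsion _ = ⊤) ∧
    (∀ e ∈ V, ∃ r, rank3Rows01[e.1]? = some r ∧ ∀ (hr : r ∈ rows) (h : r.check = true),
        (AddSubgroup.closure {r.gen₁ h, r.gen₂ h, r.gen₃ h} ⊔ AddCommGroup.torsion _).index ≤ e.2 →
          AddSubgroup.closure {r.gen₁ h, r.gen₂ h, r.gen₃ h} ⊔ AddCommGroup.torsion _ = ⊤) ∧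
      U.length = 350 ∧ V.length = 2 ∧ rank3Rows01.length = 352 ∧
      (List.range 352).filter (· ∉ (U ++ V).map Prod.fst) = [] :=
  ⟨_, _, generators01, PSatCensusS10CPS.generators01, by decide +kernel⟩

/-- **CENSUS WITH THE TAIL, chunk 02** (kernel-computed from the statements of `generators02` — list
`U`, `347` entries — and of `PSatCensusS10CPS.generators02` — list `V`, the `5` tail rows at
positions 9, 71, 90, 113, 297; nothing restated): `352` rows, and NO position remains uncovered.
[cite: CremonaPrickettSiksek2006, Thm 1] [cite: CremonaAlgorithms1997, Tables] -/
theorem censusT02 : ∃ U V : List (ℕ × ℕ),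
    (∀ e ∈ U, ∃ r, rank3Rows02[e.1]? = some r ∧ ∀ (hr : r ∈ rows) (h : r.check = true),
        (AddSubgroup.closure {r.gen₁ h, r.gen₂ h, r.gen₃ h} ⊔ AddCommGroup.torsion _).index ≤ e.2 →
          AddSubgroup.closure {r.gen₁ h, r.gen₂ h, r.gen₃ h} ⊔ AddCommGroup.torsion _ = ⊤) ∧
    (∀ e ∈ V, ∃ r, rank3Rows02[e.1]? = some r ∧ ∀ (hr : r ∈ rows) (h : r.check = true),
        (AddSubgroup.closure {r.gen₁ h, r.gen₂ h, r.gen₃ h} ⊔ AddCommGroup.torsion _).index ≤ e.2 →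
          AddSubgroup.closure {r.gen₁ h, r.gen₂ h, r.gen₃ h} ⊔ AddCommGroup.torsion _ = ⊤) ∧
      U.length = 347 ∧ V.length = 5 ∧ rank3Rows02.length = 352 ∧
      (List.range 352).filter (· ∉ (U ++ V).map Prod.fst) = [] :=
  ⟨_, _, generators02, PSatCensusS10CPS.generators02, by decide +kernel⟩

/-- **CENSUS WITH THE TAIL, chunk 03** (kernel-computed from the statements of `generators03` — list
`U`, `348` entries — and of `PSatCensusS10CPS.generators03` — list `V`, the `4` tail rows at
positions 114, 259, 307, 344; nothing restated): `352` rows, and NO position remains uncovered.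
[cite: CremonaPrickettSiksek2006, Thm 1] [cite: CremonaAlgorithms1997, Tables] -/
theorem censusT03 : ∃ U V : List (ℕ × ℕ),
    (∀ e ∈ U, ∃ r, rank3Rows03[e.1]? = some r ∧ ∀ (hr : r ∈ rows) (h : r.check = true),
        (AddSubgroup.closure {r.gen₁ h, r.gen₂ h, r.gen₃ h} ⊔ AddCommGroup.torsion _).index ≤ e.2 →
          AddSubgroup.closure {r.gen₁ h, r.gen₂ h, r.gen₃ h} ⊔ AddCommGroup.torsion _ = ⊤) ∧
    (∀ e ∈ V, ∃ r, rank3Rows03[e.1]? = some r ∧ ∀ (hr : r ∈ rows) (h : r.check = true),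
        (AddSubgroup.closure {r.gen₁ h, r.gen₂ h, r.gen₃ h} ⊔ AddCommGroup.torsion _).index ≤ e.2 →
          AddSubgroup.closure {r.gen₁ h, r.gen₂ h, r.gen₃ h} ⊔ AddCommGroup.torsion _ = ⊤) ∧
      U.length = 348 ∧ V.length = 4 ∧ rank3Rows03.length = 352 ∧
      (List.range 352).filter (· ∉ (U ++ V).map Prod.fst) = [] :=
  ⟨_, _, generators03, PSatCensusS10CPS.generators03, by decide +kernel⟩

/-- **CENSUS WITH THE TAIL, chunk 04** (kernel-computed from the statements of `generators04` — list
`U`, `344` entries — and of `PSatCensusS10CPS.generators04` — list `V`, the `8` tail rows at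
positions 11, 77, 88, 154, 181, 230, 289, 350; nothing restated): `352` rows, and NO position
remains uncovered. [cite: CremonaPrickettSiksek2006, Thm 1] [cite: CremonaAlgorithms1997, Tables] -/
theorem censusT04 : ∃ U V : List (ℕ × ℕ),
    (∀ e ∈ U, ∃ r, rank3Rows04[e.1]? = some r ∧ ∀ (hr : r ∈ rows) (h : r.check = true),
        (AddSubgroup.closure {r.gen₁ h, r.gen₂ h, r.gen₃ h} ⊔ AddCommGroup.torsion _).index ≤ e.2 →
          AddSubgroup.closure {r.gen₁ h, r.gen₂ h, r.gen₃ h} ⊔ AddCommGroup.torsion _ = ⊤) ∧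
    (∀ e ∈ V, ∃ r, rank3Rows04[e.1]? = some r ∧ ∀ (hr : r ∈ rows) (h : r.check = true),
        (AddSubgroup.closure {r.gen₁ h, r.gen₂ h, r.gen₃ h} ⊔ AddCommGroup.torsion _).index ≤ e.2 →
          AddSubgroup.closure {r.gen₁ h, r.gen₂ h, r.gen₃ h} ⊔ AddCommGroup.torsion _ = ⊤) ∧
      U.length = 344 ∧ V.length = 8 ∧ rank3Rows04.length = 352 ∧
      (List.range 352).filter (· ∉ (U ++ V).map Prod.fst) = [] :=
  ⟨_, _, generators04, PSatCensusS10CPS.generators04, by decide +kernel⟩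

/-- **CENSUS WITH THE TAIL, chunk 05** (kernel-computed from the statements of `generators05` — list
`U`, `343` entries — and of `PSatCensusS10CPS.generators05` — list `V`, the `9` tail rows at
positions 110, 121, 159, 217, 236, 237, 255, 312, 331; nothing restated): `352` rows, and NO
position remains uncovered. [cite: CremonaPrickettSiksek2006, Thm 1] [cite: CremonaAlgorithms1997,
Tables] -/
theorem censusT05 : ∃ U V : List (ℕ × ℕ),
    (∀ e ∈ U, ∃ r, rank3Rows05[e.1]? = some r ∧ ∀ (hr : r ∈ rows) (h : r.check = true),
        (AddSubgroup.closure {r.gen₁ h, r.gen₂ h, r.gen₃ h} ⊔ AddCommGroup.torsion _).index ≤ e.2 →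
          AddSubgroup.closure {r.gen₁ h, r.gen₂ h, r.gen₃ h} ⊔ AddCommGroup.torsion _ = ⊤) ∧
    (∀ e ∈ V, ∃ r, rank3Rows05[e.1]? = some r ∧ ∀ (hr : r ∈ rows) (h : r.check = true),
        (AddSubgroup.closure {r.gen₁ h, r.gen₂ h, r.gen₃ h} ⊔ AddCommGroup.torsion _).index ≤ e.2 →
          AddSubgroup.closure {r.gen₁ h, r.gen₂ h, r.gen₃ h} ⊔ AddCommGroup.torsion _ = ⊤) ∧
      U.length = 343 ∧ V.length = 9 ∧ rank3Rows05.length = 352 ∧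
      (List.range 352).filter (· ∉ (U ++ V).map Prod.fst) = [] :=
  ⟨_, _, generators05, PSatCensusS10CPS.generators05, by decide +kernel⟩

/-- **CENSUS WITH THE TAIL, chunk 06** (kernel-computed from the statements of `generators06` — list
`U`, `341` entries — and of `PSatCensusS10CPS.generators06` — list `V`, the `11` tail rows at
positions 44, 64, 76, 79, 84, 89, 150, 168, 182, 295, 335; nothing restated): `352` rows, and NO
position remains uncovered. [cite: CremonaPrickettSiksek2006, Thm 1] [cite: CremonaAlgorithms1997,
Tables] -/
theorem censusT06 : ∃ U V : List (ℕ × ℕ),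
    (∀ e ∈ U, ∃ r, rank3Rows06[e.1]? = some r ∧ ∀ (hr : r ∈ rows) (h : r.check = true),
        (AddSubgroup.closure {r.gen₁ h, r.gen₂ h, r.gen₃ h} ⊔ AddCommGroup.torsion _).index ≤ e.2 →
          AddSubgroup.closure {r.gen₁ h, r.gen₂ h, r.gen₃ h} ⊔ AddCommGroup.torsion _ = ⊤) ∧
    (∀ e ∈ V, ∃ r, rank3Rows06[e.1]? = some r ∧ ∀ (hr : r ∈ rows) (h : r.check = true),
        (AddSubgroup.closure {r.gen₁ h, r.gen₂ h, r.gen₃ h} ⊔ AddCommGroup.torsion _).index ≤ e.2 →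
          AddSubgroup.closure {r.gen₁ h, r.gen₂ h, r.gen₃ h} ⊔ AddCommGroup.torsion _ = ⊤) ∧
      U.length = 341 ∧ V.length = 11 ∧ rank3Rows06.length = 352 ∧
      (List.range 352).filter (· ∉ (U ++ V).map Prod.fst) = [] :=
  ⟨_, _, generators06, PSatCensusS10CPS.generators06, by decide +kernel⟩

/-- **CENSUS WITH THE TAIL, chunk 07** (kernel-computed from the statements of `generators07` — list
`U`, `337` entries — and of `PSatCensusS10CPS.generators07` — list `V`, the `15` tail rows at
positions 20, 34, 44, 46, 62, 92, 109, 113, 120, 240, 298, 321, 322, 328, 351; nothing restated):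
`352` rows, and NO position remains uncovered. [cite: CremonaPrickettSiksek2006, Thm 1] [cite:
CremonaAlgorithms1997, Tables] -/
theorem censusT07 : ∃ U V : List (ℕ × ℕ),
    (∀ e ∈ U, ∃ r, rank3Rows07[e.1]? = some r ∧ ∀ (hr : r ∈ rows) (h : r.check = true),
        (AddSubgroup.closure {r.gen₁ h, r.gen₂ h, r.gen₃ h} ⊔ AddCommGroup.torsion _).index ≤ e.2 →
          AddSubgroup.closure {r.gen₁ h, r.gen₂ h, r.gen₃ h} ⊔ AddCommGroup.torsion _ = ⊤) ∧
    (∀ e ∈ V, ∃ r, rank3Rows07[e.1]? = some r ∧ ∀ (hr : r ∈ rows) (h : r.check = true),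
        (AddSubgroup.closure {r.gen₁ h, r.gen₂ h, r.gen₃ h} ⊔ AddCommGroup.torsion _).index ≤ e.2 →
          AddSubgroup.closure {r.gen₁ h, r.gen₂ h, r.gen₃ h} ⊔ AddCommGroup.torsion _ = ⊤) ∧
      U.length = 337 ∧ V.length = 15 ∧ rank3Rows07.length = 352 ∧
      (List.range 352).filter (· ∉ (U ++ V).map Prod.fst) = [] :=
  ⟨_, _, generators07, PSatCensusS10CPS.generators07, by decide +kernel⟩

/-- **CENSUS WITH THE TAIL, chunk 08** (kernel-computed from the statements of `generators08` — list
`U`, `340` entries — and of `PSatCensusS10CPS.generators08` — list `V`, the `12` tail rows at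
positions 82, 83, 116, 141, 195, 234, 248, 267, 275, 295, 302, 317; nothing restated): `352` rows,
and NO position remains uncovered. [cite: CremonaPrickettSiksek2006, Thm 1] [cite:
CremonaAlgorithms1997, Tables] -/
theorem censusT08 : ∃ U V : List (ℕ × ℕ),
    (∀ e ∈ U, ∃ r, rank3Rows08[e.1]? = some r ∧ ∀ (hr : r ∈ rows) (h : r.check = true),
        (AddSubgroup.closure {r.gen₁ h, r.gen₂ h, r.gen₃ h} ⊔ AddCommGroup.torsion _).index ≤ e.2 →
          AddSubgroup.closure {r.gen₁ h, r.gen₂ h, r.gen₃ h} ⊔ AddCommGroup.torsion _ = ⊤) ∧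
    (∀ e ∈ V, ∃ r, rank3Rows08[e.1]? = some r ∧ ∀ (hr : r ∈ rows) (h : r.check = true),
        (AddSubgroup.closure {r.gen₁ h, r.gen₂ h, r.gen₃ h} ⊔ AddCommGroup.torsion _).index ≤ e.2 →
          AddSubgroup.closure {r.gen₁ h, r.gen₂ h, r.gen₃ h} ⊔ AddCommGroup.torsion _ = ⊤) ∧
      U.length = 340 ∧ V.length = 12 ∧ rank3Rows08.length = 352 ∧
      (List.range 352).filter (· ∉ (U ++ V).map Prod.fst) = [] :=
  ⟨_, _, generators08, PSatCensusS10CPS.generators08, by decide +kernel⟩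

/-- **CENSUS WITH THE TAIL, chunk 09** (kernel-computed from the statements of `generators09` — list
`U`, `344` entries — and of `PSatCensusS10CPS.generators09` — list `V`, the `8` tail rows at
positions 101, 188, 207, 208, 229, 230, 244, 268; nothing restated): `352` rows, and NO position
remains uncovered. [cite: CremonaPrickettSiksek2006, Thm 1] [cite: CremonaAlgorithms1997, Tables] -/
theorem censusT09 : ∃ U V : List (ℕ × ℕ),
    (∀ e ∈ U, ∃ r, rank3Rows09[e.1]? = some r ∧ ∀ (hr : r ∈ rows) (h : r.check = true),
        (AddSubgroup.closure {r.gen₁ h, r.gen₂ h, r.gen₃ h} ⊔ AddCommGroup.torsion _).index ≤ e.2 →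
          AddSubgroup.closure {r.gen₁ h, r.gen₂ h, r.gen₃ h} ⊔ AddCommGroup.torsion _ = ⊤) ∧
    (∀ e ∈ V, ∃ r, rank3Rows09[e.1]? = some r ∧ ∀ (hr : r ∈ rows) (h : r.check = true),
        (AddSubgroup.closure {r.gen₁ h, r.gen₂ h, r.gen₃ h} ⊔ AddCommGroup.torsion _).index ≤ e.2 →
          AddSubgroup.closure {r.gen₁ h, r.gen₂ h, r.gen₃ h} ⊔ AddCommGroup.torsion _ = ⊤) ∧
      U.length = 344 ∧ V.length = 8 ∧ rank3Rows09.length = 352 ∧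
      (List.range 352).filter (· ∉ (U ++ V).map Prod.fst) = [] :=
  ⟨_, _, generators09, PSatCensusS10CPS.generators09, by decide +kernel⟩

/-- **CENSUS WITH THE TAIL, chunk 10** (kernel-computed from the statements of `generators10` — list
`U`, `340` entries — and of `PSatCensusS10CPS.generators10` — list `V`, the `12` tail rows at
positions 10, 79, 114, 143, 204, 254, 262, 274, 313, 319, 320, 349; nothing restated): `352` rows,
and NO position remains uncovered. [cite: CremonaPrickettSiksek2006, Thm 1] [cite:
CremonaAlgorithms1997, Tables] -/
theorem censusT10 : ∃ U V : List (ℕ × ℕ),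
    (∀ e ∈ U, ∃ r, rank3Rows10[e.1]? = some r ∧ ∀ (hr : r ∈ rows) (h : r.check = true),
        (AddSubgroup.closure {r.gen₁ h, r.gen₂ h, r.gen₃ h} ⊔ AddCommGroup.torsion _).index ≤ e.2 →
          AddSubgroup.closure {r.gen₁ h, r.gen₂ h, r.gen₃ h} ⊔ AddCommGroup.torsion _ = ⊤) ∧
    (∀ e ∈ V, ∃ r, rank3Rows10[e.1]? = some r ∧ ∀ (hr : r ∈ rows) (h : r.check = true),
        (AddSubgroup.closure {r.gen₁ h, r.gen₂ h, r.gen₃ h} ⊔ AddCommGroup.torsion _).index ≤ e.2 →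
          AddSubgroup.closure {r.gen₁ h, r.gen₂ h, r.gen₃ h} ⊔ AddCommGroup.torsion _ = ⊤) ∧
      U.length = 340 ∧ V.length = 12 ∧ rank3Rows10.length = 352 ∧
      (List.range 352).filter (· ∉ (U ++ V).map Prod.fst) = [] :=
  ⟨_, _, generators10, PSatCensusS10CPS.generators10, by decide +kernel⟩

/-- **CENSUS WITH THE TAIL, chunk 11** (kernel-computed from the statements of `generators11` — list
`U`, `332` entries — and of `PSatCensusS10CPS.generators11` — list `V`, the `20` tail rows at
positions 6, 7, 51, 89, 106, 119, 122, 141, 142, 163, 177, 207, 214, 237, 264, 265, 281, 328, 338,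
349; nothing restated): `352` rows, and NO position remains uncovered. [cite:
CremonaPrickettSiksek2006, Thm 1] [cite: CremonaAlgorithms1997, Tables] -/
theorem censusT11 : ∃ U V : List (ℕ × ℕ),
    (∀ e ∈ U, ∃ r, rank3Rows11[e.1]? = some r ∧ ∀ (hr : r ∈ rows) (h : r.check = true),
        (AddSubgroup.closure {r.gen₁ h, r.gen₂ h, r.gen₃ h} ⊔ AddCommGroup.torsion _).index ≤ e.2 →
          AddSubgroup.closure {r.gen₁ h, r.gen₂ h, r.gen₃ h} ⊔ AddCommGroup.torsion _ = ⊤) ∧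
    (∀ e ∈ V, ∃ r, rank3Rows11[e.1]? = some r ∧ ∀ (hr : r ∈ rows) (h : r.check = true),
        (AddSubgroup.closure {r.gen₁ h, r.gen₂ h, r.gen₃ h} ⊔ AddCommGroup.torsion _).index ≤ e.2 →
          AddSubgroup.closure {r.gen₁ h, r.gen₂ h, r.gen₃ h} ⊔ AddCommGroup.torsion _ = ⊤) ∧
      U.length = 332 ∧ V.length = 20 ∧ rank3Rows11.length = 352 ∧
      (List.range 352).filter (· ∉ (U ++ V).map Prod.fst) = [] :=
  ⟨_, _, generators11, PSatCensusS10CPS.generators11, by decide +kernel⟩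

/-- **CENSUS WITH THE TAIL, chunk 12** (kernel-computed from the statements of `generators12` — list
`U`, `339` entries — and of `PSatCensusS10CPS.generators12` — list `V`, the `13` tail rows at
positions 93, 132, 133, 136, 172, 189, 218, 233, 234, 251, 292, 296, 330; nothing restated): `352`
rows, and NO position remains uncovered. [cite: CremonaPrickettSiksek2006, Thm 1] [cite:
CremonaAlgorithms1997, Tables] -/
theorem censusT12 : ∃ U V : List (ℕ × ℕ),
    (∀ e ∈ U, ∃ r, rank3Rows12[e.1]? = some r ∧ ∀ (hr : r ∈ rows) (h : r.check = true),
        (AddSubgroup.closure {r.gen₁ h, r.gen₂ h, r.gen₃ h} ⊔ AddCommGroup.torsion _).index ≤ e.2 →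
          AddSubgroup.closure {r.gen₁ h, r.gen₂ h, r.gen₃ h} ⊔ AddCommGroup.torsion _ = ⊤) ∧
    (∀ e ∈ V, ∃ r, rank3Rows12[e.1]? = some r ∧ ∀ (hr : r ∈ rows) (h : r.check = true),
        (AddSubgroup.closure {r.gen₁ h, r.gen₂ h, r.gen₃ h} ⊔ AddCommGroup.torsion _).index ≤ e.2 →
          AddSubgroup.closure {r.gen₁ h, r.gen₂ h, r.gen₃ h} ⊔ AddCommGroup.torsion _ = ⊤) ∧
      U.length = 339 ∧ V.length = 13 ∧ rank3Rows12.length = 352 ∧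
      (List.range 352).filter (· ∉ (U ++ V).map Prod.fst) = [] :=
  ⟨_, _, generators12, PSatCensusS10CPS.generators12, by decide +kernel⟩

/-- **CENSUS WITH THE TAIL, chunk 13** (kernel-computed from the statements of `generators13` — list
`U`, `340` entries — and of `PSatCensusS10CPS.generators13` — list `V`, the `12` tail rows at
positions 95, 104, 112, 113, 130, 170, 173, 197, 251, 256, 285, 336; nothing restated): `352` rows,
and NO position remains uncovered. [cite: CremonaPrickettSiksek2006, Thm 1] [cite:
CremonaAlgorithms1997, Tables] -/
theorem censusT13 : ∃ U V : List (ℕ × ℕ),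
    (∀ e ∈ U, ∃ r, rank3Rows13[e.1]? = some r ∧ ∀ (hr : r ∈ rows) (h : r.check = true),
        (AddSubgroup.closure {r.gen₁ h, r.gen₂ h, r.gen₃ h} ⊔ AddCommGroup.torsion _).index ≤ e.2 →
          AddSubgroup.closure {r.gen₁ h, r.gen₂ h, r.gen₃ h} ⊔ AddCommGroup.torsion _ = ⊤) ∧
    (∀ e ∈ V, ∃ r, rank3Rows13[e.1]? = some r ∧ ∀ (hr : r ∈ rows) (h : r.check = true),
        (AddSubgroup.closure {r.gen₁ h, r.gen₂ h, r.gen₃ h} ⊔ AddCommGroup.torsion _).index ≤ e.2 →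
          AddSubgroup.closure {r.gen₁ h, r.gen₂ h, r.gen₃ h} ⊔ AddCommGroup.torsion _ = ⊤) ∧
      U.length = 340 ∧ V.length = 12 ∧ rank3Rows13.length = 352 ∧
      (List.range 352).filter (· ∉ (U ++ V).map Prod.fst) = [] :=
  ⟨_, _, generators13, PSatCensusS10CPS.generators13, by decide +kernel⟩

/-- **CENSUS WITH THE TAIL, chunk 14** (kernel-computed from the statements of `generators14` — list
`U`, `343` entries — and of `PSatCensusS10CPS.generators14` — list `V`, the `9` tail rows at
positions 15, 59, 256, 276, 294, 297, 309, 310, 319; nothing restated): `352` rows, and NO position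
remains uncovered. [cite: CremonaPrickettSiksek2006, Thm 1] [cite: CremonaAlgorithms1997, Tables] -/
theorem censusT14 : ∃ U V : List (ℕ × ℕ),
    (∀ e ∈ U, ∃ r, rank3Rows14[e.1]? = some r ∧ ∀ (hr : r ∈ rows) (h : r.check = true),
        (AddSubgroup.closure {r.gen₁ h, r.gen₂ h, r.gen₃ h} ⊔ AddCommGroup.torsion _).index ≤ e.2 →
          AddSubgroup.closure {r.gen₁ h, r.gen₂ h, r.gen₃ h} ⊔ AddCommGroup.torsion _ = ⊤) ∧
    (∀ e ∈ V, ∃ r, rank3Rows14[e.1]? = some r ∧ ∀ (hr : r ∈ rows) (h : r.check = true),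
        (AddSubgroup.closure {r.gen₁ h, r.gen₂ h, r.gen₃ h} ⊔ AddCommGroup.torsion _).index ≤ e.2 →
          AddSubgroup.closure {r.gen₁ h, r.gen₂ h, r.gen₃ h} ⊔ AddCommGroup.torsion _ = ⊤) ∧
      U.length = 343 ∧ V.length = 9 ∧ rank3Rows14.length = 352 ∧
      (List.range 352).filter (· ∉ (U ++ V).map Prod.fst) = [] :=
  ⟨_, _, generators14, PSatCensusS10CPS.generators14, by decide +kernel⟩


end GeneratorsCensus

end Summit.BirchSwinnertonDyer.BirchSwinnertonDyer.Rank2Observatory
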